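import Literature.NumberTheory.Transcendental.KZIntervalPeriodProofs
import Literature.NumberTheory.Transcendental.SemialgebraicLineDeriv
import Literature.NumberTheory.Transcendental.KZCubicalCalculus
import Summits.KontsevichZagierPeriods.KontsevichZagierPeriods.Theorems.UnfoldedStokesStokesGenerationStubRungCertificate
import Mathlib.Analysis.Calculus.Deriv.Inv
import Mathlib.Analysis.Calculus.Deriv.Mul

/-!
# `StokesGeneration` (stmt-KontsevichZagierPeriods-3586) — line `fibrewise_stokes`, stub `stub_paramDlogCertificate`

Registered stub (wave 2) of the line `fibrewise_stokes` of the crux `StokesGeneration` (route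
UnfoldedStokes): **rung 1's two-element divergence certificate with silent parameters** on the
closed cube `[0,1]⁴` (loop variable `x 2`, auxiliary variable `x 3`, parameters `x 0`, `x 1`).

Let `R₁ m`, `R₂ m` be finitely many positive continuous `ℚ`-semialgebraic functions on the cube,
independent of `x 2` and `x 3`, with `∏ R₁ m = ∏ R₂ m`, and let `γ` be real algebraic. The deformed
loop `P = (∏ (1 + x₂ (R₁ m − 1))) / (∏ (1 + x₂ (R₂ m − 1)))` is positive on the cube (each factor
is `(1 − x₂) + x₂ R > 0`), equals `1` on the faces `x₂ = 0` (trivially) and `x₂ = 1` (by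
`∏ R₁ m = ∏ R₂ m`), and its logarithmic derivative along `x₂` is
`L = Σ (R₁ m − 1)/(1 + x₂ (R₁ m − 1)) − Σ (R₂ m − 1)/(1 + x₂ (R₂ m − 1))` (Leibniz rule for a
finite product of affine functions of `x₂`). Exactly as in rung 1 (`stub_rungCertificate`), with
`P' = P L` and `E = 1 + (P − 1) x₃ > 0`, the primitives `G₀ = γ (P − 1)/E` (direction `2`) and
`G₁ = γ x₃ P' (1/P − 1/E)` (direction `3`) have fibre derivatives `D₀ = γ P'/E²` and
`D₁ = γ P' (1/P − 1/E²)` with `D₀ + D₁ = γ P'/P = γ L`, all four boundary values vanish on the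
cube, and the two fibrewise Stokes elements `Dⱼ − (Gⱼ|₁ − Gⱼ|₀) = Dⱼ` are carried by the closed
cube with the continuous (hence bounded and integrable) `ℚ`-semialgebraic integrands `Dⱼ`.
Semialgebraicity is closure of `ℚ`-semialgebraic functions under field operations, finite sums and
finite products (Bochnak–Coste–Roy, Prop. 2.2.6) applied to the atoms `R₁ m`, `R₂ m`, `x 2`,
`x 3`, `γ`, `1`.

References: J. Ayoub, *Une version relative de la conjecture des périodes de Kontsevich–Zagier*,
Ann. of Math. 181 (2015), Rem. 1.5; M. Kontsevich, D. Zagier, *Periods* (2001), §1.2;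
J. Bochnak, M. Coste, M.-F. Roy, *Real Algebraic Geometry* (1998), Prop. 2.2.6.
-/

noncomputable section

-- `Summit.KontsevichZagierPeriods.KontsevichZagierPeriods.…` is the tree's mandated layout (single-conjunct summit).
set_option linter.dupNamespace false

namespace Summit.KontsevichZagierPeriods.KontsevichZagierPeriods.Cruxes.StokesGeneration.FibrewiseStokes

open MeasureTheory Set
open Literature.NumberTheory.Transcendental
open Literature.NumberTheory.Transcendental.KZ
open Literature.ModelTheory.ExponentialFields (IsSemialgebraic)

/-! ## The derivative of a finite product of affine functions -/

/-- Leibniz rule in logarithmic form: `d/dv ∏ᵢ (1 + v aᵢ) |_{v=u} = (∏ᵢ (1 + u aᵢ)) · Σᵢ aᵢ/(1 + u aᵢ)`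
at a point `u` where no factor vanishes. [folklore] -/
theorem paramDlog_hasDerivAt_prod {n : ℕ} (a : Fin n → ℝ) {u : ℝ} (h : ∀ i, 1 + u * a i ≠ 0) :
    HasDerivAt (fun v => ∏ i, (1 + v * a i))
      ((∏ i, (1 + u * a i)) * ∑ i, a i / (1 + u * a i)) u := by
  have h1 : ∀ i ∈ Finset.univ, HasDerivAt (fun v => 1 + v * a i) (1 * a i) u :=
    fun i _ => ((hasDerivAt_id' u).mul_const (a i)).const_add 1
  refine (HasDerivAt.fun_finsetProd h1).congr_deriv ?_
  rw [Finset.mul_sum]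
  refine Finset.sum_congr rfl fun i _ => ?_
  rw [smul_eq_mul, one_mul,
    ← Finset.prod_erase_mul Finset.univ (fun j => 1 + u * a j) (Finset.mem_univ i)]
  have := h i
  field_simp

/-- Quotient rule in logarithmic form: the `v`-derivative at `u` of the ratio
`(∏ᵢ (1 + v aᵢ)) / (∏ᵢ (1 + v bᵢ))` is the ratio times `Σᵢ aᵢ/(1 + u aᵢ) − Σᵢ bᵢ/(1 + u bᵢ)`,
provided no factor vanishes at `u`. [folklore] -/
theorem paramDlog_hasDerivAt_ratio {n₁ n₂ : ℕ} (a : Fin n₁ → ℝ) (b : Fin n₂ → ℝ) {u : ℝ}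
    (ha : ∀ i, 1 + u * a i ≠ 0) (hb : ∀ i, 1 + u * b i ≠ 0) :
    HasDerivAt (fun v => (∏ i, (1 + v * a i)) / ∏ i, (1 + v * b i))
      ((∏ i, (1 + u * a i)) / (∏ i, (1 + u * b i)) *
        (∑ i, a i / (1 + u * a i) - ∑ i, b i / (1 + u * b i))) u := by
  have hB : ∏ i, (1 + u * b i) ≠ 0 := Finset.prod_ne_zero_iff.2 fun i _ => hb i
  refine ((paramDlog_hasDerivAt_prod a ha).div (paramDlog_hasDerivAt_prod b hb) hB).congr_deriv ?_
  field_simp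

/-- `Fin.natAdd 2 0 = 2` in `Fin 4` (element `0` lives in direction `2`). [folklore] -/
theorem paramDlog_natAdd_zero : (Fin.natAdd 2 (0 : Fin 2) : Fin 4) = 2 := rfl

/-- `Fin.natAdd 2 1 = 3` in `Fin 4` (element `1` lives in direction `3`). [folklore] -/
theorem paramDlog_natAdd_one : (Fin.natAdd 2 (1 : Fin 2) : Fin 4) = 3 := rfl

/-! ## The certificate -/

/-- **Registered stub `stub_paramDlogCertificate` (wave 2): rung 1's two-element divergence
certificate with silent parameters.** On the closed cube `[0,1]⁴`, for positive continuous
`ℚ`-semialgebraic `R₁ m`, `R₂ m` independent of `x 2`, `x 3` with `∏ R₁ m = ∏ R₂ m` and `γ` real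
algebraic, `γ` times the logarithmic `x₂`-derivative
`Σ (R₁ m − 1)/(1 + x₂ (R₁ m − 1)) − Σ (R₂ m − 1)/(1 + x₂ (R₂ m − 1))` of the deformed loop
`P = ∏ (1 + x₂ (R₁ m − 1)) / ∏ (1 + x₂ (R₂ m − 1))` is the sum of two fibrewise Stokes elements,
with primitives `G₀ = γ (P − 1)/(1 + (P − 1) x₃)` (direction `2`) and
`G₁ = γ x₃ P' (1/P − 1/(1 + (P − 1) x₃))`, `P' = P L` (direction `3`); all four boundary terms
vanish on the cube and `∂₂ G₀ + ∂₃ G₁ = γ P'/P = γ L`. [cite: Ayoub2015, Rem. 1.5] -/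
theorem stub_paramDlogCertificate :
    ∀ (γ : ℝ) (n₁ n₂ : ℕ) (R₁ : Fin n₁ → (Fin 4 → ℝ) → ℝ) (R₂ : Fin n₂ → (Fin 4 → ℝ) → ℝ), IsAlgebraic ℚ γ →
      (∀ m, IsSemialgebraicFunOn ℚ (Set.pi Set.univ (fun _ : Fin 4 => Set.Icc (0:ℝ) 1)) (R₁ m)) →
      (∀ m, IsSemialgebraicFunOn ℚ (Set.pi Set.univ (fun _ : Fin 4 => Set.Icc (0:ℝ) 1)) (R₂ m)) →
      (∀ m, ∀ x ∈ Set.pi Set.univ (fun _ : Fin 4 => Set.Icc (0:ℝ) 1), ∀ s ∈ Set.Icc (0:ℝ) 1,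
        R₁ m (Function.update x 2 s) = R₁ m x ∧ R₁ m (Function.update x 3 s) = R₁ m x) →
      (∀ m, ∀ x ∈ Set.pi Set.univ (fun _ : Fin 4 => Set.Icc (0:ℝ) 1), ∀ s ∈ Set.Icc (0:ℝ) 1,
        R₂ m (Function.update x 2 s) = R₂ m x ∧ R₂ m (Function.update x 3 s) = R₂ m x) →
      (∀ m, ∀ x ∈ Set.pi Set.univ (fun _ : Fin 4 => Set.Icc (0:ℝ) 1), 0 < R₁ m x) →
      (∀ m, ∀ x ∈ Set.pi Set.univ (fun _ : Fin 4 => Set.Icc (0:ℝ) 1), 0 < R₂ m x) →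
      (∀ m, ContinuousOn (R₁ m) (Set.pi Set.univ (fun _ : Fin 4 => Set.Icc (0:ℝ) 1))) →
      (∀ m, ContinuousOn (R₂ m) (Set.pi Set.univ (fun _ : Fin 4 => Set.Icc (0:ℝ) 1))) →
      (∀ x ∈ Set.pi Set.univ (fun _ : Fin 4 => Set.Icc (0:ℝ) 1), ∏ m, R₁ m x = ∏ m, R₂ m x) →
      ∃ (G D : Fin 2 → (Fin 4 → ℝ) → ℝ) (r : Fin 2 → IntegralRep 4),
        (∀ j, IsSemialgebraicFunOn ℚ (Set.pi Set.univ (fun _ : Fin 4 => Set.Icc (0:ℝ) 1)) (G j) ∧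
          IsSemialgebraicFunOn ℚ (Set.pi Set.univ (fun _ : Fin 4 => Set.Icc (0:ℝ) 1)) (D j) ∧
          (∃ B : ℝ, ∀ x ∈ Set.pi Set.univ (fun _ : Fin 4 => Set.Icc (0:ℝ) 1), |(G j) x| ≤ B) ∧
          (∀ x ∈ Set.pi Set.univ (fun _ : Fin 4 => Set.Icc (0:ℝ) 1),
            ContinuousOn (fun s : ℝ => (G j) (Function.update x (Fin.natAdd 2 j) s)) (Set.Icc (0:ℝ) 1)) ∧
          (∀ x ∈ Set.pi Set.univ (fun _ : Fin 4 => Set.Icc (0:ℝ) 1), x (Fin.natAdd 2 j) ∈ Set.Ioo (0:ℝ) 1 →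
            HasDerivAt (fun s : ℝ => (G j) (Function.update x (Fin.natAdd 2 j) s)) ((D j) x) (x (Fin.natAdd 2 j)))) ∧
        (∀ j, (r j).domain = Set.pi Set.univ (fun _ : Fin 4 => Set.Icc (0:ℝ) 1) ∧
          ∀ x ∈ Set.pi Set.univ (fun _ : Fin 4 => Set.Icc (0:ℝ) 1), (r j).integrand x =
            D j x - (G j (Function.update x (Fin.natAdd 2 j) 1) - G j (Function.update x (Fin.natAdd 2 j) 0))) ∧
        ∀ x ∈ Set.pi Set.univ (fun _ : Fin 4 => Set.Icc (0:ℝ) 1),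
          γ * (∑ m, (R₁ m x - 1) / (1 + x 2 * (R₁ m x - 1)) - ∑ m, (R₂ m x - 1) / (1 + x 2 * (R₂ m x - 1))) =
            ∑ j, (r j).integrand x := by
  intro γ n₁ n₂ R₁ R₂ hγ hR₁sa hR₂sa hR₁inv hR₂inv hR₁pos hR₂pos hR₁c hR₂c hprod
  -- the closed cube and what holds on it
  set S : Set (Fin 4 → ℝ) := Set.pi Set.univ (fun _ : Fin 4 => Set.Icc (0:ℝ) 1) with hS
  have hSsa : IsSemialgebraic ℚ S := by rw [hS, ← cube_eq_pi]; exact isSemialgebraic_cube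
  have hSc : IsCompact S := isCompact_univ_pi fun _ => isCompact_Icc
  have h23 : (2 : Fin 4) ≠ 3 := by decide
  have h32 : (3 : Fin 4) ≠ 2 := by decide
  have hmem : ∀ x ∈ S, ∀ i, x i ∈ Set.Icc (0:ℝ) 1 := fun x hx i => (Set.mem_univ_pi.mp hx) i
  -- moving one coordinate inside `[0,1]` stays in the cube
  have hupd : ∀ x ∈ S, ∀ (j : Fin 4), ∀ s ∈ Set.Icc (0:ℝ) 1, Function.update x j s ∈ S := by
    intro x hx j s hs
    refine Set.mem_univ_pi.mpr fun i => ?_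
    rcases eq_or_ne i j with rfl | hij
    · simpa using hs
    · rw [Function.update_of_ne hij]
      exact hmem x hx i
  -- the affine factors `1 + x₂ (R − 1) = (1 − x₂) + x₂ R` are positive on the cube
  have hfac : ∀ x ∈ S, ∀ ρ : ℝ, 0 < ρ → 0 < 1 + x 2 * (ρ - 1) := by
    intro x hx ρ hρ
    obtain ⟨h2l, h2u⟩ := hmem x hx 2
    rcases eq_or_lt_of_le h2u with h | h
    · rw [h]; linarith
    · nlinarith [mul_nonneg h2l hρ.le]
  have hf₁ : ∀ m, ∀ x ∈ S, 0 < 1 + x 2 * (R₁ m x - 1) := fun m x hx => hfac x hx _ (hR₁pos m x hx)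
  have hf₂ : ∀ m, ∀ x ∈ S, 0 < 1 + x 2 * (R₂ m x - 1) := fun m x hx => hfac x hx _ (hR₂pos m x hx)
  have hf₁ne : ∀ m, ∀ x ∈ S, 1 + x 2 * (R₁ m x - 1) ≠ 0 := fun m x hx => (hf₁ m x hx).ne'
  have hf₂ne : ∀ m, ∀ x ∈ S, 1 + x 2 * (R₂ m x - 1) ≠ 0 := fun m x hx => (hf₂ m x hx).ne'
  -- the deformed loop `P`, its logarithmic `x₂`-derivative `L`, `P' = P L`, `E = 1 + (P − 1) x₃`
  set A : (Fin 4 → ℝ) → ℝ := fun x => ∏ m, (1 + x 2 * (R₁ m x - 1)) with hA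
  set Bd : (Fin 4 → ℝ) → ℝ := fun x => ∏ m, (1 + x 2 * (R₂ m x - 1)) with hBd
  set P : (Fin 4 → ℝ) → ℝ := fun x => A x / Bd x with hP
  set L : (Fin 4 → ℝ) → ℝ := fun x =>
    ∑ m, (R₁ m x - 1) / (1 + x 2 * (R₁ m x - 1)) - ∑ m, (R₂ m x - 1) / (1 + x 2 * (R₂ m x - 1))
    with hL
  set P' : (Fin 4 → ℝ) → ℝ := fun x => P x * L x with hP'
  set E : (Fin 4 → ℝ) → ℝ := fun x => 1 + (P x - 1) * x 3 with hE
  have hApos : ∀ x ∈ S, 0 < A x := fun x hx => Finset.prod_pos fun m _ => hf₁ m x hx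
  have hBpos : ∀ x ∈ S, 0 < Bd x := fun x hx => Finset.prod_pos fun m _ => hf₂ m x hx
  have hBne : ∀ x ∈ S, Bd x ≠ 0 := fun x hx => (hBpos x hx).ne'
  have hPpos : ∀ x ∈ S, 0 < P x := fun x hx => div_pos (hApos x hx) (hBpos x hx)
  have hPne : ∀ x ∈ S, P x ≠ 0 := fun x hx => (hPpos x hx).ne'
  have hEpos : ∀ x ∈ S, 0 < E x := by
    intro x hx
    obtain ⟨h3l, h3u⟩ := hmem x hx 3
    have hp := hPpos x hx
    show 0 < 1 + (P x - 1) * x 3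
    rcases le_total 1 (P x) with h | h
    · nlinarith [mul_nonneg (sub_nonneg.2 h) h3l]
    · nlinarith [mul_nonneg (sub_nonneg.2 h) (sub_nonneg.2 h3u)]
  have hEne : ∀ x ∈ S, E x ≠ 0 := fun x hx => (hEpos x hx).ne'
  have hE2ne : ∀ x ∈ S, E x ^ 2 ≠ 0 := fun x hx => pow_ne_zero 2 (hEne x hx)
  -- `P = 1` on the faces `x₂ = 0` and `x₂ = 1`; `P`, `L` do not depend on `x₃`; the `x₂`-fibre of `P`
  have hP20 : ∀ x, P (Function.update x 2 0) = 1 := fun x => by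
    simp only [hP, hA, hBd, Function.update_self, zero_mul, add_zero, Finset.prod_const_one, div_one]
  have hP21 : ∀ x ∈ S, P (Function.update x 2 1) = 1 := by
    intro x hx
    have hy : Function.update x 2 1 ∈ S := hupd x hx 2 1 ⟨zero_le_one, le_rfl⟩
    have hne : ∏ m, R₂ m (Function.update x 2 1) ≠ 0 :=
      (Finset.prod_pos fun m _ => hR₂pos m _ hy).ne'
    simp only [hP, hA, hBd, Function.update_self, one_mul, add_sub_cancel, hprod _ hy, div_self hne]
  have hPL3 : ∀ x ∈ S, ∀ s ∈ Set.Icc (0:ℝ) 1,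
      P (Function.update x 3 s) = P x ∧ L (Function.update x 3 s) = L x := by
    intro x hx s hs
    have h1 : ∀ m, R₁ m (Function.update x 3 s) = R₁ m x := fun m => (hR₁inv m x hx s hs).2
    have h2 : ∀ m, R₂ m (Function.update x 3 s) = R₂ m x := fun m => (hR₂inv m x hx s hs).2
    simp only [hP, hA, hBd, hL, Function.update_of_ne h23, h1, h2, and_self]
  have hP2 : ∀ x ∈ S, ∀ s ∈ Set.Icc (0:ℝ) 1, P (Function.update x 2 s) =
      (∏ m, (1 + s * (R₁ m x - 1))) / ∏ m, (1 + s * (R₂ m x - 1)) := by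
    intro x hx s hs
    have h1 : ∀ m, R₁ m (Function.update x 2 s) = R₁ m x := fun m => (hR₁inv m x hx s hs).1
    have h2 : ∀ m, R₂ m (Function.update x 2 s) = R₂ m x := fun m => (hR₂inv m x hx s hs).1
    simp only [hP, hA, hBd, Function.update_self, h1, h2]
  -- semialgebraic atoms and closure under field operations (BCR Prop. 2.2.6)
  have h1sa : IsSemialgebraicFunOn ℚ S (fun _ => (1:ℝ)) :=
    isSemialgebraicFunOn_const_of_isAlgebraic hSsa isAlgebraic_one
  have hγsa : IsSemialgebraicFunOn ℚ S (fun _ => γ) :=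
    isSemialgebraicFunOn_const_of_isAlgebraic hSsa hγ
  have hx2sa : IsSemialgebraicFunOn ℚ S (fun x => x 2) := isSemialgebraicFunOn_apply hSsa 2
  have hx3sa : IsSemialgebraicFunOn ℚ S (fun x => x 3) := isSemialgebraicFunOn_apply hSsa 3
  have hf₁sa : ∀ m, IsSemialgebraicFunOn ℚ S (fun x => 1 + x 2 * (R₁ m x - 1)) := fun m =>
    h1sa.fun_add (hx2sa.fun_mul ((hR₁sa m).fun_sub h1sa))
  have hf₂sa : ∀ m, IsSemialgebraicFunOn ℚ S (fun x => 1 + x 2 * (R₂ m x - 1)) := fun m =>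
    h1sa.fun_add (hx2sa.fun_mul ((hR₂sa m).fun_sub h1sa))
  have hAsa : IsSemialgebraicFunOn ℚ S A :=
    IsSemialgebraicFunOn.fun_finsetProd Finset.univ hSsa fun m _ => hf₁sa m
  have hBsa : IsSemialgebraicFunOn ℚ S Bd :=
    IsSemialgebraicFunOn.fun_finsetProd Finset.univ hSsa fun m _ => hf₂sa m
  have hPsa : IsSemialgebraicFunOn ℚ S P := hAsa.div hBsa hBne
  have hLsa : IsSemialgebraicFunOn ℚ S L :=
    (IsSemialgebraicFunOn.fun_finsetSum Finset.univ hSsa fun m _ =>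
        ((hR₁sa m).fun_sub h1sa).div (hf₁sa m) (hf₁ne m)).fun_sub
      (IsSemialgebraicFunOn.fun_finsetSum Finset.univ hSsa fun m _ =>
        ((hR₂sa m).fun_sub h1sa).div (hf₂sa m) (hf₂ne m))
  have hP'sa : IsSemialgebraicFunOn ℚ S P' := hPsa.fun_mul hLsa
  have hEsa : IsSemialgebraicFunOn ℚ S E := h1sa.fun_add ((hPsa.fun_sub h1sa).fun_mul hx3sa)
  -- continuity atoms on the cube
  have hx2c : ContinuousOn (fun x : Fin 4 → ℝ => x 2) S := (continuous_apply 2).continuousOn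
  have hx3c : ContinuousOn (fun x : Fin 4 → ℝ => x 3) S := (continuous_apply 3).continuousOn
  have hf₁c : ∀ m, ContinuousOn (fun x : Fin 4 → ℝ => 1 + x 2 * (R₁ m x - 1)) S := fun m =>
    continuousOn_const.fun_add (hx2c.fun_mul ((hR₁c m).fun_sub continuousOn_const))
  have hf₂c : ∀ m, ContinuousOn (fun x : Fin 4 → ℝ => 1 + x 2 * (R₂ m x - 1)) S := fun m =>
    continuousOn_const.fun_add (hx2c.fun_mul ((hR₂c m).fun_sub continuousOn_const))
  have hAc : ContinuousOn A S := continuousOn_finsetProd _ fun m _ => hf₁c m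
  have hBc : ContinuousOn Bd S := continuousOn_finsetProd _ fun m _ => hf₂c m
  have hPc : ContinuousOn P S := hAc.div₀ hBc hBne
  have hLc : ContinuousOn L S :=
    (continuousOn_finsetSum _ fun m _ =>
        ((hR₁c m).fun_sub continuousOn_const).div₀ (hf₁c m) (hf₁ne m)).fun_sub
      (continuousOn_finsetSum _ fun m _ =>
        ((hR₂c m).fun_sub continuousOn_const).div₀ (hf₂c m) (hf₂ne m))
  have hP'c : ContinuousOn P' S := hPc.fun_mul hLc
  have hEc : ContinuousOn E S :=
    continuousOn_const.fun_add ((hPc.fun_sub continuousOn_const).fun_mul hx3c)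
  have hE2c : ContinuousOn (fun x => E x ^ 2) S := hEc.pow 2
  -- the witnesses
  set G0 : (Fin 4 → ℝ) → ℝ := fun x => γ * (P x - 1) / E x with hG0
  set D0 : (Fin 4 → ℝ) → ℝ := fun x => γ * P' x / E x ^ 2 with hD0
  set G1 : (Fin 4 → ℝ) → ℝ := fun x => γ * x 3 * P' x * (1 / P x - 1 / E x) with hG1
  set D1 : (Fin 4 → ℝ) → ℝ := fun x => γ * P' x * (1 / P x - 1 / E x ^ 2) with hD1
  -- semialgebraicity
  have hG0sa : IsSemialgebraicFunOn ℚ S G0 := (hγsa.fun_mul (hPsa.fun_sub h1sa)).div hEsa hEne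
  have hD0sa : IsSemialgebraicFunOn ℚ S D0 := (hγsa.fun_mul hP'sa).div (hEsa.fun_pow 2) hE2ne
  have hG1sa : IsSemialgebraicFunOn ℚ S G1 :=
    ((hγsa.fun_mul hx3sa).fun_mul hP'sa).fun_mul
      ((h1sa.div hPsa hPne).fun_sub (h1sa.div hEsa hEne))
  have hD1sa : IsSemialgebraicFunOn ℚ S D1 :=
    (hγsa.fun_mul hP'sa).fun_mul ((h1sa.div hPsa hPne).fun_sub (h1sa.div (hEsa.fun_pow 2) hE2ne))
  -- continuity on the cube
  have hG0c : ContinuousOn G0 S :=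
    (continuousOn_const.fun_mul (hPc.fun_sub continuousOn_const)).div₀ hEc hEne
  have hD0c : ContinuousOn D0 S := (continuousOn_const.fun_mul hP'c).div₀ hE2c hE2ne
  have hG1c : ContinuousOn G1 S :=
    ((continuousOn_const.fun_mul hx3c).fun_mul hP'c).fun_mul
      ((continuousOn_const.div₀ hPc hPne).fun_sub (continuousOn_const.div₀ hEc hEne))
  have hD1c : ContinuousOn D1 S :=
    (continuousOn_const.fun_mul hP'c).fun_mul
      ((continuousOn_const.div₀ hPc hPne).fun_sub (continuousOn_const.div₀ hE2c hE2ne))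
  -- derivatives along open fibres: direction `2` for `G0`, direction `3` for `G1`
  have hGder0 : ∀ x ∈ S, x 2 ∈ Set.Ioo (0:ℝ) 1 →
      HasDerivAt (fun s : ℝ => G0 (Function.update x 2 s)) (D0 x) (x 2) := by
    intro x hx hx2
    have hp : HasDerivAt (fun v => (∏ m, (1 + v * (R₁ m x - 1))) / ∏ m, (1 + v * (R₂ m x - 1)))
        (P' x) (x 2) :=
      paramDlog_hasDerivAt_ratio (fun m => R₁ m x - 1) (fun m => R₂ m x - 1)
        (fun m => hf₁ne m x hx) (fun m => hf₂ne m x hx)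
    have key := rungCert_hasDerivAt_dir0 (γ := γ) (y := x 3) hp (hEne x hx)
    refine (key.congr_of_eventuallyEq ?_).congr_deriv rfl
    refine Filter.eventuallyEq_of_mem (Ioo_mem_nhds hx2.1 hx2.2) fun s hs => ?_
    simp only [hG0, hE, hP2 x hx s (Set.Ioo_subset_Icc_self hs), Function.update_of_ne h32]
  have hGder1 : ∀ x ∈ S, x 3 ∈ Set.Ioo (0:ℝ) 1 →
      HasDerivAt (fun s : ℝ => G1 (Function.update x 3 s)) (D1 x) (x 3) := by
    intro x hx hx3
    have key := rungCert_hasDerivAt_dir1 (γ := γ) (a := P' x) (p := P x) (c := P x - 1)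
      (s := x 3) (hEne x hx)
    refine (key.congr_of_eventuallyEq ?_).congr_deriv rfl
    refine Filter.eventuallyEq_of_mem (Ioo_mem_nhds hx3.1 hx3.2) fun s hs => ?_
    have h := hPL3 x hx s (Set.Ioo_subset_Icc_self hs)
    simp only [hG1, hP', hE, h.1, h.2, Function.update_self]
  -- packaged as `Fin 2`-families (element `j` lives in direction `Fin.natAdd 2 j`)
  set G : Fin 2 → (Fin 4 → ℝ) → ℝ := ![G0, G1] with hG
  set D : Fin 2 → (Fin 4 → ℝ) → ℝ := ![D0, D1] with hD
  have hGsa : ∀ j, IsSemialgebraicFunOn ℚ S (G j) := Fin.forall_fin_two.2 ⟨hG0sa, hG1sa⟩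
  have hDsa : ∀ j, IsSemialgebraicFunOn ℚ S (D j) := Fin.forall_fin_two.2 ⟨hD0sa, hD1sa⟩
  have hGc : ∀ j, ContinuousOn (G j) S := Fin.forall_fin_two.2 ⟨hG0c, hG1c⟩
  have hDc : ∀ j, ContinuousOn (D j) S := Fin.forall_fin_two.2 ⟨hD0c, hD1c⟩
  -- all four boundary values vanish on the cube
  have hG_one : ∀ j, ∀ x ∈ S, G j (Function.update x (Fin.natAdd 2 j) 1) = 0 := by
    refine Fin.forall_fin_two.2 ⟨fun x hx => ?_, fun x _ => ?_⟩
    · rw [paramDlog_natAdd_zero]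
      simp only [hG, Matrix.cons_val_zero, hG0, hP21 x hx, sub_self, mul_zero, zero_div]
    · rw [paramDlog_natAdd_one]
      simp only [hG, hG1, Matrix.cons_val_one, Matrix.cons_val_fin_one, hE, Function.update_self]
      ring
  have hG_zero : ∀ j, ∀ x ∈ S, G j (Function.update x (Fin.natAdd 2 j) 0) = 0 := by
    refine Fin.forall_fin_two.2 ⟨fun x _ => ?_, fun x _ => ?_⟩
    · rw [paramDlog_natAdd_zero]
      simp only [hG, Matrix.cons_val_zero, hG0, hP20 x, sub_self, mul_zero, zero_div]
    · rw [paramDlog_natAdd_one]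
      simp only [hG, hG1, Matrix.cons_val_one, Matrix.cons_val_fin_one, Function.update_self,
        mul_zero, zero_mul]
  -- bounds on the compact cube
  have hGbd : ∀ j, ∃ B : ℝ, ∀ x ∈ S, |G j x| ≤ B := fun j => by
    obtain ⟨B, hB⟩ := hSc.exists_bound_of_continuousOn (hGc j)
    exact ⟨B, fun x hx => by simpa only [Real.norm_eq_abs] using hB x hx⟩
  -- continuity along closed fibres
  have hGfib : ∀ j, ∀ x ∈ S, ContinuousOn
      (fun s : ℝ => G j (Function.update x (Fin.natAdd 2 j) s)) (Set.Icc (0:ℝ) 1) := by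
    intro j x hx
    have hc : Continuous fun s : ℝ => Function.update x (Fin.natAdd 2 j) s :=
      continuous_const.update (Fin.natAdd 2 j) continuous_id
    exact (hGc j).comp hc.continuousOn fun s hs => hupd x hx _ s hs
  -- derivatives along open fibres
  have hGder : ∀ j, ∀ x ∈ S, x (Fin.natAdd 2 j) ∈ Set.Ioo (0:ℝ) 1 →
      HasDerivAt (fun s : ℝ => G j (Function.update x (Fin.natAdd 2 j) s)) (D j x)
        (x (Fin.natAdd 2 j)) := by
    refine Fin.forall_fin_two.2 ⟨?_, ?_⟩
    · rw [paramDlog_natAdd_zero]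
      exact hGder0
    · rw [paramDlog_natAdd_one]
      exact hGder1
  -- the two closed-cube representations, with integrands `D j`
  let r : Fin 2 → IntegralRep 4 := fun j =>
    { domain := S
      integrand := D j
      isSemialgebraic_domain := hSsa
      isSemialgebraicFunOn_integrand := hDsa j
      integrableOn := (hDc j).integrableOn_compact hSc }
  refine ⟨G, D, r, fun j => ⟨hGsa j, hDsa j, hGbd j, hGfib j, hGder j⟩,
    fun j => ⟨rfl, fun x hx => ?_⟩, fun x hx => ?_⟩
  · -- the integrand clause: boundary terms vanish
    show D j x = D j x - (G j (Function.update x (Fin.natAdd 2 j) 1) -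
      G j (Function.update x (Fin.natAdd 2 j) 0))
    rw [hG_one j x hx, hG_zero j x hx, sub_zero, sub_zero]
  · -- the identity `γ L = D₀ + D₁ = γ P'/P`
    show γ * L x = ∑ j, D j x
    rw [Fin.sum_univ_two]
    simp only [hD, hD0, hD1, hP', Matrix.cons_val_zero, Matrix.cons_val_one,
      Matrix.cons_val_fin_one]
    have h : P x * L x * (1 / P x) = L x := by
      rw [mul_comm (P x) (L x), mul_assoc, mul_one_div_cancel (hPne x hx), mul_one]
    linear_combination (-γ) * h

end Summit.KontsevichZagierPeriods.KontsevichZagierPeriods.Cruxes.StokesGeneration.FibrewiseStokes
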